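import Mathlib.Analysis.SpecialFunctions.SmoothTransition
import Mathlib.LinearAlgebra.CrossProduct
import Literature.Analysis.FluidPDE.OnsagerBDSVPerturbation
import Literature.Analysis.FluidPDE.MikadoDisjointPipes
import HarnessLib

/-!
# Mikado flows on a neighbourhood of the identity (BDSV Lemma 5.1): the fields `W`, `V`

Buckmaster–De Lellis–Székelyhidi–Vicol, *Onsager's conjecture for admissible weak solutions*, CPAM 72
(2019) = arXiv:1701.08678, Lemma 5.1, quote the Mikado flows of Daneri–Székelyhidi (ARMA 224 (2017),
Lemma 2.3): for a compact `𝒩 ⊂ 𝒮₊^{3×3}` a smooth `W : 𝒩 × T³ → ℝ³` with `div_ξ(W ⊗ W) = 0`,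
`div_ξ W = 0`, `⨍ W = 0`, `⨍ W ⊗ W = R`; BDSV (5.9) add the vector potential. The named fact
`BDSV.mikado_exists` (`OnsagerBDSVPerturbation.lean`) asks for this, as a `BDSV.MikadoDatum`, on the
sup-ball `𝒩 = {R = Rᵀ : ‖R - Id‖_∞ ≤ 1/10}`. This file DEFINES the fields of the printed proof of DaSz17
Lemma 2.3 —

> look for `W(R, ξ) = ∑_k Γ_k(R) ψ_k(ξ) k`, `ψ_k` a profile around the `T³`-periodic line through `p_k` in
> direction `k`, the `p_k` chosen so that `supp ψ_i ∩ supp ψ_j = ∅`; `∫ ψ_k = 0`, `⨍ ψ_k² = 1`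

— from ingredients proved in the tree: the geometric lemma near `Id` with the fifteen directions
`k_x ∈ {e_i, e_i ± 2e_j}` and radius `r₃ = 1/10` (`NashGeometric.decomposition`, `le_coeffSq`); the
Cheskidov–Luo pipe profiles `ψ_x = Δ φ_x` pulled back along integer transverse forms (`MikadoFlows`);
their shifted, pairwise disjoint versions in `T³` (`MikadoShiftedPipes`, `MikadoDisjointPipes`:
`Mikado.psiS`, `Mikado.shift`, `Mikado.pipeConc = 60`, `Mikado.tube_disjoint`). Contents:

* `BDSV.slack`, `BDSV.mikadoCoeff x R = √(slack (Γ_x(R)²))`: a GLOBALLY smooth version of the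
  coefficient `Γ_x = √(Γ_x²)` of the geometric lemma, equal to it on the ball (where `Γ_x² ≥ 1/80`) —
  `MikadoDatum` asks for smoothness on all of `ℝ^{3×3} × ℝ³`; `BDSV.sum_mikadoCoeff_sq`: `R = ∑ Γ̃² k ⊗ k`;
* the profiles `BDSV.pipePsi x = ψ_x(· - p_x)`, `BDSV.pipePhi x = φ_x(· - p_x)` at scale `μ₀ = 60`, with
  `Δφ = ψ`, invariance of `ψ_x`, `∂_cφ_x` along `k_x`, `ψ_x ψ_{x'} = 0 = ψ_{x'} (k_{x'}·∇)ψ_x` (`x ≠ x'`),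
  `∫ψ = 0`, `∫ψ² = 1`, `∫∂ₗφ = 0`;
* **the Mikado flows** `BDSV.mikadoW R ξ = ∑_x Γ̃_x(R) ψ_x(ξ) k_x` and **the potential**
  `BDSV.mikadoV R ξ = ∑_x Γ̃_x(R) k_x × ∇φ_x(ξ)` — the physical-space form of (5.9):
  `V = curl (-Δ)⁻¹ W`, since `-Δ⁻¹(ψ k) = -φ k` and `curl(-φ k) = k × ∇φ` — with their components;
* two calculus helpers (`∂ⱼ` of `∑ c_x f_x` and of `a f - b g`).

## Mathlib / tree search

Used from Mathlib: `Real.smoothTransition` (for `slack`), `ContDiff.sqrt`, `crossProduct` (`⨯₃`,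
`cross_apply`) on `Fin 3 → ℝ` transported to `EuclideanSpace ℝ (Fin 3)` by `WithLp.toLp/ofLp`,
`contDiff_euclidean`. From the tree: `NashGeometric.coeffSq/coeff/decomposition/le_coeffSq/contDiff_coeffSq`
(radius `NashGeometric.radius (Fin 3) = 1/10 = BDSV.mikadoRadius`), `Mikado.psiS/phiS/shift/pipeConc` and
their calculus (`MikadoShiftedPipes`, `MikadoDisjointPipes`), the torus calculus of `FunctionSpaces.Torus`
(`partialDeriv_finset_sum`, `Torus.partialDeriv_const_mul_apply`, `Torus.partialDeriv_sub_at`,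
`fderiv_apply_eq_sum_partialDeriv`, `integral_partialDeriv_eq_zero_holds`). No Mikado-flow construction with
disjoint supports exists in Mathlib or the tree (`CP25.nash_lemma` has radius `1/500 < 1/10`; the CL22
files use temporally separated, spatially intersecting pipes).

The identities (`div W = 0`, `(W·∇)W = 0`, `∫W = 0`, `∫ WᵢWⱼ = Rᵢⱼ`, `curl V = W`, `div V = 0`, `∫V = 0`),
the datum and `BDSV.mikado_exists_holds` are in `OnsagerBDSVPerturbationProofs`. Everything is proved.

## References

* T. Buckmaster, C. De Lellis, L. Székelyhidi Jr., V. Vicol, CPAM 72 (2019) 229–274 = arXiv:1701.08678,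
  §5.1, Lemma 5.1 and (5.7)–(5.9). [`BuckmasterEtAl2018`]
* S. Daneri, L. Székelyhidi Jr., ARMA 224 (2017) = arXiv:1603.09714, Lemma 2.3 and its proof, Lemma 2.4.
  [`DaneriSzekelyhidi2017`]
-/

open MeasureTheory Set
open scoped ContDiff Matrix Matrix.Norms.Elementwise

noncomputable section

namespace Literature.Analysis.FluidPDE

namespace BDSV

open FunctionSpaces FunctionSpaces.Torus NashGeometric

/-- The flat three-torus `T³ = (ℝ/ℤ)³`, local notation. -/
local notation "𝕋³" => UnitAddTorus (Fin 3)

/-- Euclidean `ℝ³`, local notation. -/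
local notation "ℝ³" => EuclideanSpace ℝ (Fin 3)

/-- Real `3 × 3` matrices, local notation. -/
local notation "𝕄" => Matrix (Fin 3) (Fin 3) ℝ

/-! ## Globally smooth coefficients -/

section Coeff

/-- A smooth function `ℝ → ℝ` with `slack t = t` for `t ≥ 1/80` and `slack > 0` everywhere:
`slack t = 1/160 + (t - 1/160) S(160 t - 1)` with Mathlib's `Real.smoothTransition` `S`. [folklore] -/
def slack (t : ℝ) : ℝ := 1 / 160 + (t - 1 / 160) * Real.smoothTransition (160 * t - 1)

/-- `slack t = t` for `t ≥ 1/80`. [folklore] -/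
theorem slack_eq_self {t : ℝ} (ht : 1 / 80 ≤ t) : slack t = t := by
  rw [slack, Real.smoothTransition.one_of_one_le (by linarith), mul_one]
  ring

/-- `slack > 0`. [folklore] -/
theorem slack_pos (t : ℝ) : 0 < slack t := by
  unfold slack
  by_cases ht : t ≤ 1 / 160
  · rw [Real.smoothTransition.zero_of_nonpos (by linarith), mul_zero, add_zero]
    norm_num
  · have h : 0 ≤ (t - 1 / 160) * Real.smoothTransition (160 * t - 1) :=
      mul_nonneg (by linarith) (Real.smoothTransition.nonneg _)
    linarith

/-- `slack` is smooth. [folklore] -/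
theorem contDiff_slack : ContDiff ℝ ∞ slack := by
  have h : ContDiff ℝ ∞ fun t : ℝ => Real.smoothTransition (160 * t - 1) :=
    Real.smoothTransition.contDiff.comp ((contDiff_const.mul contDiff_id).sub contDiff_const)
  exact contDiff_const.add ((contDiff_id.sub contDiff_const).mul h)

/-- **The smoothed coefficients** `Γ̃_x(R) = √(slack(Γ_x(R)²))` of the geometric lemma: smooth on all of
`ℝ^{3×3}` and equal to `Γ_x = √(Γ_x²)` (`NashGeometric.coeff`) on the ball `‖R - Id‖_∞ ≤ 1/10`, where
`Γ_x² ≥ 1/80` (`NashGeometric.le_coeffSq`). (DaSz17 Lemma 2.4 / BDSV Lemma 5.1 only use `Γ_k` on `𝒩`;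
`BDSV.MikadoDatum` records smoothness on the whole matrix space.) [cite: DaneriSzekelyhidi2017, Lemma 2.4] -/
def mikadoCoeff (x : Index (Fin 3)) (R : 𝕄) : ℝ := Real.sqrt (slack (coeffSq R x))

/-- `Γ̃_x` is smooth on `ℝ^{3×3}`. [folklore] -/
theorem contDiff_mikadoCoeff (x : Index (Fin 3)) : ContDiff ℝ ∞ (mikadoCoeff x) := by
  have h1 : ContDiff ℝ ∞ fun R : 𝕄 => coeffSq R x := contDiff_coeffSq x
  exact (contDiff_slack.comp h1).sqrt fun R => (slack_pos _).ne'

/-- `r₃ = 1/10 = mikadoRadius`. [folklore] -/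
theorem radius_fin_three : radius (Fin 3) = mikadoRadius := by
  norm_num [radius, mikadoRadius]

/-- On the ball `‖R - Id‖_∞ ≤ 1/10` the sup-distance to `NashGeometric.idMat` is `≤ r₃`. [folklore] -/
theorem dist_idMat_le {R : 𝕄} (hR : R ∈ Metric.closedBall (1 : 𝕄) mikadoRadius) :
    dist (fun i j => R i j) (idMat : Fin 3 → Fin 3 → ℝ) ≤ radius (Fin 3) := by
  have h1 : (idMat : Fin 3 → Fin 3 → ℝ) = fun i j => (1 : 𝕄) i j := by
    funext i j
    simp [idMat, Matrix.one_apply]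
  rw [h1, radius_fin_three]
  exact Metric.mem_closedBall.1 hR

/-- `Γ̃_x = Γ_x` on the ball. [folklore] -/
theorem mikadoCoeff_eq_coeff {R : 𝕄} (hR : R ∈ Metric.closedBall (1 : 𝕄) mikadoRadius)
    (x : Index (Fin 3)) : mikadoCoeff x R = coeff x R := by
  have h := le_coeffSq (d := Fin 3) (by simp) (dist_idMat_le hR) x
  rw [radius_fin_three, mikadoRadius] at h
  unfold mikadoCoeff coeff
  rw [slack_eq_self (by norm_num at h ⊢; exact h)]

/-- **The geometric lemma on the ball, with the smoothed coefficients**: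
`R_ab = ∑_x Γ̃_x(R)² (k_x)_a (k_x)_b` for symmetric `R` with `‖R - Id‖_∞ ≤ 1/10`.
[cite: DaneriSzekelyhidi2017, Lemma 2.4] -/
theorem sum_mikadoCoeff_sq {R : 𝕄} (hR : R ∈ Metric.closedBall (1 : 𝕄) mikadoRadius) (hsym : R.IsSymm)
    (a b : Fin 3) : ∑ x, mikadoCoeff x R ^ 2 * (((dir x a : ℤ) : ℝ) * ((dir x b : ℤ) : ℝ)) = R a b := by
  have hd : dist (fun i j => R i j) (idMat : Fin 3 → Fin 3 → ℝ) ≤ 2 * radius (Fin 3) :=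
    (dist_idMat_le hR).trans (by rw [radius_fin_three, mikadoRadius]; norm_num)
  have h := decomposition (d := Fin 3) (by simp) (fun i j => (hsym.apply j i)) hd a b
  rw [h]
  exact Finset.sum_congr rfl fun x _ => by rw [mikadoCoeff_eq_coeff hR x]

end Coeff

/-! ## The pipes -/

section Pipes

/-- The pipe profile `ψ_x(· - p_x)` of direction `k_x` at scale `μ₀ = 60` (`Mikado.psiS`).
[cite: DaneriSzekelyhidi2017, Lemma 2.3 (proof)] -/
def pipePsi (x : Index (Fin 3)) : 𝕋³ → ℝ := Mikado.psiS x Mikado.pipeConc (Mikado.shift x)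

/-- The potential `φ_x(· - p_x)`, `Δ φ_x = ψ_x` (`Mikado.phiS`). [folklore] -/
def pipePhi (x : Index (Fin 3)) : 𝕋³ → ℝ := Mikado.phiS x Mikado.pipeConc (Mikado.shift x)

/-- `ψ_x` is smooth. [folklore] -/
theorem isSmooth_pipePsi (x : Index (Fin 3)) : IsSmooth (pipePsi x) :=
  Mikado.isSmooth_psiS x Mikado.one_le_pipeConc _

/-- `φ_x` is smooth. [folklore] -/
theorem isSmooth_pipePhi (x : Index (Fin 3)) : IsSmooth (pipePhi x) :=
  Mikado.isSmooth_phiS x Mikado.one_le_pipeConc _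

/-- `Δ φ_x = ψ_x`. [folklore] -/
theorem laplacian_pipePhi (x : Index (Fin 3)) : laplacian (pipePhi x) = pipePsi x :=
  Mikado.laplacian_phiS x Mikado.one_le_pipeConc _

/-- `∑ₗ (k_x)ₗ ∂ₗ ψ_x = 0`: the profile is constant along the pipe. [folklore] -/
theorem sum_dirVec_mul_partialDeriv_pipePsi (x : Index (Fin 3)) (ξ : 𝕋³) :
    ∑ l, Mikado.dirVec x l * partialDeriv l (pipePsi x) ξ = 0 := by
  have h := Mikado.fderiv_psiS_dirVec x Mikado.one_le_pipeConc (Mikado.shift x) ξ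
  change Torus.fderiv (pipePsi x) ξ (Mikado.dirVec x) = 0 at h
  rw [fderiv_apply_eq_sum_partialDeriv ((isSmooth_pipePsi x).isContDiff (by simp))] at h
  simpa [smul_eq_mul] using h

/-- `∑ₗ (k_x)ₗ ∂ₗ ∂_c φ_x = 0`: the gradient of the potential is constant along the pipe. [folklore] -/
theorem sum_dirVec_mul_partialDeriv_partialDeriv_pipePhi (x : Index (Fin 3)) (c : Fin 3) (ξ : 𝕋³) :
    ∑ l, Mikado.dirVec x l * partialDeriv l (partialDeriv c (pipePhi x)) ξ = 0 := by
  have h := Mikado.fderiv_partialDeriv_phiS_dirVec x Mikado.one_le_pipeConc (Mikado.shift x) c ξ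
  change Torus.fderiv (partialDeriv c (pipePhi x)) ξ (Mikado.dirVec x) = 0 at h
  rw [fderiv_apply_eq_sum_partialDeriv (((isSmooth_pipePhi x).partialDeriv c).isContDiff (by simp))] at h
  simpa [smul_eq_mul] using h

/-- Disjoint pipes: `ψ_x ψ_{x'} = 0` for `x ≠ x'`. [cite: DaneriSzekelyhidi2017, Lemma 2.3 (proof)] -/
theorem pipePsi_mul_pipePsi {x x' : Index (Fin 3)} (h : x ≠ x') (ξ : 𝕋³) : pipePsi x ξ * pipePsi x' ξ = 0 :=
  Mikado.psiS_mul_psiS_eq_zero h le_rfl ξ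

/-- Straight disjoint pipes do not interact: `ψ_{x'} (k_{x'}·∇) ψ_x = 0` for all `x, x'`
(`x = x'`: invariance; `x ≠ x'`: disjointness). [cite: DaneriSzekelyhidi2017, Lemma 2.3 (proof)] -/
theorem pipePsi_mul_sum_dirVec_mul_partialDeriv (x x' : Index (Fin 3)) (ξ : 𝕋³) :
    pipePsi x' ξ * ∑ l, Mikado.dirVec x' l * partialDeriv l (pipePsi x) ξ = 0 := by
  by_cases h : x = x'
  · subst h
    rw [sum_dirVec_mul_partialDeriv_pipePsi, mul_zero]
  · rw [Finset.mul_sum]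
    refine Finset.sum_eq_zero fun l _ => ?_
    have h0 := Mikado.psiS_mul_partialDeriv_psiS_eq_zero h (le_refl Mikado.pipeConc) l ξ
    calc pipePsi x' ξ * (Mikado.dirVec x' l * partialDeriv l (pipePsi x) ξ)
        = Mikado.dirVec x' l * (pipePsi x' ξ * partialDeriv l (pipePsi x) ξ) := by ring
      _ = 0 := by rw [show pipePsi x' ξ * partialDeriv l (pipePsi x) ξ = 0 from h0, mul_zero]

/-- `∫ ψ_x = 0`. [folklore] -/
theorem integral_pipePsi (x : Index (Fin 3)) : ∫ ξ, pipePsi x ξ = 0 :=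
  Mikado.integral_psiS x Mikado.one_le_pipeConc _

/-- `∫ ψ_x² = 1`. [folklore] -/
theorem integral_pipePsi_sq (x : Index (Fin 3)) : ∫ ξ, pipePsi x ξ ^ 2 = 1 :=
  Mikado.integral_psiS_sq (by simp) x Mikado.one_le_pipeConc _

/-- `∫ ∂ₗ φ_x = 0`. [folklore] -/
theorem integral_partialDeriv_pipePhi (x : Index (Fin 3)) (l : Fin 3) :
    ∫ ξ, partialDeriv l (pipePhi x) ξ = 0 :=
  integral_partialDeriv_eq_zero_holds (isSmooth_pipePhi x) l

end Pipes

/-! ## The Mikado flows and their potential -/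

section Fields

/-- **The Mikado flows** `W(R, ξ) = ∑_x Γ̃_x(R) ψ_x(ξ) k_x` (DaSz17 (proof of Lemma 2.3); BDSV Lemma 5.1).
[cite: BuckmasterEtAl2018, Lemma 5.1] -/
def mikadoW (R : 𝕄) (ξ : 𝕋³) : ℝ³ :=
  ∑ x, (mikadoCoeff x R * pipePsi x ξ) • Mikado.dirVec x

/-- The gradient `∇φ_x(ξ) = (∂₀φ_x, ∂₁φ_x, ∂₂φ_x)(ξ)` as a coordinate vector `Fin 3 → ℝ`. [folklore] -/
def pipeGrad (x : Index (Fin 3)) (ξ : 𝕋³) : Fin 3 → ℝ := fun l => partialDeriv l (pipePhi x) ξ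

/-- **The vector potential** `V(R, ξ) = ∑_x Γ̃_x(R) k_x × ∇φ_x(ξ)` with `curl V = W`, `div V = 0`,
`∫ V = 0` — the field (5.9) `∑_k a_k(R) (ik × A_k)/|k|² e^{ik·ξ} = curl (-Δ)⁻¹ W` in physical space
(`×` is Mathlib's `crossProduct`, `⨯₃`, on coordinate vectors). [cite: BuckmasterEtAl2018, §5.1 (5.9)] -/
def mikadoV (R : 𝕄) (ξ : 𝕋³) : ℝ³ :=
  ∑ x, mikadoCoeff x R • WithLp.toLp 2 (WithLp.ofLp (Mikado.dirVec x) ⨯₃ pipeGrad x ξ)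

/-- Components of `W`: `W(R, ξ)_i = ∑_x Γ̃_x(R) ψ_x(ξ) (k_x)_i`. [folklore] -/
theorem mikadoW_apply (R : 𝕄) (ξ : 𝕋³) (i : Fin 3) :
    mikadoW R ξ i = ∑ x, mikadoCoeff x R * pipePsi x ξ * Mikado.dirVec x i := by
  simp [mikadoW, WithLp.ofLp_sum, mul_assoc]

/-- `(k_x)_i = dir x i`. [folklore] -/
theorem dirVec_apply (x : Index (Fin 3)) (i : Fin 3) : Mikado.dirVec x i = ((dir x i : ℤ) : ℝ) := rfl

/-- Components of `V`: `V_0 = ∑ Γ̃ (k₁ ∂₂φ - k₂ ∂₁φ)`. [folklore] -/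
theorem mikadoV_apply_zero (R : 𝕄) (ξ : 𝕋³) : mikadoV R ξ 0 =
    ∑ x, mikadoCoeff x R * (Mikado.dirVec x 1 * partialDeriv 2 (pipePhi x) ξ -
      Mikado.dirVec x 2 * partialDeriv 1 (pipePhi x) ξ) := by
  simp [mikadoV, cross_apply, pipeGrad, WithLp.ofLp_sum]

/-- Components of `V`: `V_1 = ∑ Γ̃ (k₂ ∂₀φ - k₀ ∂₂φ)`. [folklore] -/
theorem mikadoV_apply_one (R : 𝕄) (ξ : 𝕋³) : mikadoV R ξ 1 =
    ∑ x, mikadoCoeff x R * (Mikado.dirVec x 2 * partialDeriv 0 (pipePhi x) ξ -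
      Mikado.dirVec x 0 * partialDeriv 2 (pipePhi x) ξ) := by
  simp [mikadoV, cross_apply, pipeGrad, WithLp.ofLp_sum]

/-- Components of `V`: `V_2 = ∑ Γ̃ (k₀ ∂₁φ - k₁ ∂₀φ)`. [folklore] -/
theorem mikadoV_apply_two (R : 𝕄) (ξ : 𝕋³) : mikadoV R ξ 2 =
    ∑ x, mikadoCoeff x R * (Mikado.dirVec x 0 * partialDeriv 1 (pipePhi x) ξ -
      Mikado.dirVec x 1 * partialDeriv 0 (pipePhi x) ξ) := by
  simp [mikadoV, cross_apply, pipeGrad, WithLp.ofLp_sum]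

end Fields

/-! ## Calculus helpers -/

section Calculus

/-- `∂ⱼ ∑_x c_x f_x = ∑_x c_x ∂ⱼ f_x` for smooth `f_x`. [folklore] -/
theorem partialDeriv_sum_const_mul {ι : Type*} [Fintype ι] (c : ι → ℝ) {f : ι → 𝕋³ → ℝ}
    (hf : ∀ x, IsSmooth (f x)) (j : Fin 3) (ξ : 𝕋³) :
    partialDeriv j (fun y => ∑ x, c x * f x y) ξ = ∑ x, c x * partialDeriv j (f x) ξ := by
  have h1 : ∀ x, IsContDiff 1 (f x) := fun x => (hf x).isContDiff (by simp)
  have h2 : ∀ x, IsContDiff 1 (fun y => c x * f x y) := fun x => ContDiff.mul contDiff_const (h1 x)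
  rw [partialDeriv_finset_sum _ (fun x _ => h2 x) j ξ]
  exact Finset.sum_congr rfl fun x _ => Torus.partialDeriv_const_mul_apply (h1 x) (c x) j ξ

/-- `∂ⱼ (a f - b g) = a ∂ⱼf - b ∂ⱼg` for smooth `f, g`. [folklore] -/
theorem partialDeriv_mul_sub_mul {f g : 𝕋³ → ℝ} (hf : IsSmooth f) (hg : IsSmooth g) (a b : ℝ)
    (j : Fin 3) (ξ : 𝕋³) :
    partialDeriv j (fun y => a * f y - b * g y) ξ = a * partialDeriv j f ξ - b * partialDeriv j g ξ := by
  have hf1 : IsContDiff 1 f := hf.isContDiff (by simp)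
  have hg1 : IsContDiff 1 g := hg.isContDiff (by simp)
  have hf2 : IsContDiff 1 fun y => a * f y := ContDiff.mul contDiff_const hf1
  have hg2 : IsContDiff 1 fun y => b * g y := ContDiff.mul contDiff_const hg1
  rw [Torus.partialDeriv_sub_at (f := fun y => a * f y) (g := fun y => b * g y) hf2 hg2,
    Torus.partialDeriv_const_mul_apply hf1, Torus.partialDeriv_const_mul_apply hg1]

/-- Smoothness of `y ↦ a f(y) - b g(y)`. [folklore] -/
theorem isSmooth_mul_sub_mul {f g : 𝕋³ → ℝ} (hf : IsSmooth f) (hg : IsSmooth g) (a b : ℝ) :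
    IsSmooth fun y => a * f y - b * g y := by
  show ContDiff ℝ ∞ fun v : ℝ³ => a * f (proj v) - b * g (proj v)
  exact (contDiff_const.mul hf).sub (contDiff_const.mul hg)

end Calculus

end BDSV

end Literature.Analysis.FluidPDE
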